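import Literature.MathematicalPhysics.QuantumFieldTheory.Balaban1983to89.B4TorusKernel

/-!
# `BalabanUV.Beta.GAN24.AliasTiling` — binder row G-an2-4 / (CONV-C), S-slot road «S3-fibre²», register engine «ALIAS-DECIMATE*» part 1/2:
# THE ZONE INTEGRAL OF A PERIODIC FUNCTION IS THE ALIAS AVERAGE OF ITS CONTRACTED TRANSLATES —
# `∫_{[−π,π]^{d+1}} g = L^{−(d+1)} Σ_{l ∈ {0,…,L−1}^{d+1}} ∫_{[−π,π]^{d+1}} g((p + 2πl)/L) dp` (pure measure theory on `ℝ^{d+1}`)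

NOT IN PRINT; OUR PROOF ATTEMPT (of the road; THIS file is [folklore] measure theory: Lebesgue measure on `ℝ^{d+1}` is translation
invariant and scales by `L^{d+1}`, the `L^{d+1}` half-open boxes `∏_i (((2l_i−1)π)/L, ((2l_i+1)π)/L]` tile the period box
`∏_i (−π/L, 2π − π/L]` disjointly, and a `2πℤ^{d+1}`-periodic function integrates over every period box like over the Brillouin zone
— Mathlib's `UnitAddTorus.integral_preimage` at two corners; no estimate, no cited fact, no `def … : Prop`, no wall binder, no object of
an2's typed `U = 1` system).  G-an2-4 formalisation swarm, leaf prover 17 (unit `b2b-balaban-gan24-formalise-leaf-17`, gen 11), register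
tag «ALIAS-DECIMATE*» (cell journal INTENT l.4515, RESULT l.4568; FILED under this name on the row owner's ruling, gan24-p1-g4 RULINGS-6 l.4599
«file as `GAN24/AliasTiling` + `GAN24/AliasDecimate`»; typer `GAN24/Formal/LEAVES.md` § II.D, T-E1 class: generic `d`, name outside `StencilSlot*`); the holder of E3 `GAN24/PushSumNest` (position-space nesting of an2's pushes) and E8 `AliasNest` (alias-frame nesting).
HONEST FRAMING (cell contract, verbatim): «discharging `BetaPertH` makes Bałaban's UV stability UNCONDITIONAL — a real constructive-QFT
result; it is NOT the continuum limit and NOT the Clay problem.»  HONEST DEPENDENCY (verbatim): «continuum YM on T⁴ ⇐ BetaPertH ∧ nine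
spine estimates (0/9 proved); BetaPertH ⇐ (D1) ∧ (D4) ∧ CAP+tail; G-an2-4 gates asym, D1 and NE2/3/4.»  NOT summit progress; nothing of
(CONV-C)'s S-slot («E3Shape» ∕ «E3SupRate», OPEN, not in print) is discharged here.

WHERE IT SITS (context only, asserted nowhere below).  Part 2 `GAN24/AliasDecimate` turns the identity of this file into
DECIMATION = ALIASING for pv17's `B4ContourShift.latticeKernel`: `latticeKernel G (L•z + r) = latticeKernel (aliasSym L r G) z` — the
Fourier side of reading a fine-lattice kernel on the coarser lattice `L•ℤ^{d+1} + r`, i.e. of an2's `BalabanCompositeJets.pushSum`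
(`GAN24/PushSumNest.pushSum_inr_inl_coarse`) and of the re-framing of every leg between two blocking levels; that is the input the
S3 skeleton's I-L3 `pushSum_symbol` (typer cut R6-symbol) and the fine-momentum plane-wave symbols of an1∕an3's finite stencils
(`GAN24/AveragingContourSymbols`, R5) need to enter the COARSE-momentum frame of the owner's `E3Sym` (I-L1).  The corner-independence
step (§2) is re-proved from leaf-07-g9's records `LatticeKernelDiagonal.v1.lean` §2 (`setIntegral_cell_eq_of_periodic`,
`setIntegral_BZ_comp_add_of_periodic`; credited, not importable at the time of writing) in the half-open-box form used here.

## What is proved ([folklore], `0 sorry`; `ℝ^{d+1}`, generic `d`; `g : ℝ^{d+1} → ℂ`)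
* §1 `periodic_update_int`, `periodic_add_intVec`: coordinatewise `2π`-periodicity ⇒ `g(p + 2πk) = g(p)` for `k ∈ ℤ^{d+1}`.
* §2 PERIOD BOXES `pbox a = ∏_i (a_i, a_i + 2π]`: `setIntegral_ucell_eq_of_periodic` (corner independence of the unit-cell integral of
  `x ↦ F(2πx)`), `pbox_eq_smul_ucell`, **`setIntegral_pbox_eq_of_periodic`** (corner independence for period boxes, unconditional in
  `F` beyond periodicity), `pbox_neg_pi_ae_eq_BZ`, **`setIntegral_pbox_eq_BZ`** (`∫_{pbox a} F = ∫_{BZ} F`).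
* §3 ALIAS BOXES `abox L l = ∏_i (((2l_i−1)π)/L, ((2l_i+1)π)/L]`, `l : Fin (d+1) → Fin L`: `disjoint_abox` (pairwise disjoint),
  `abox_subset_pbox`, `exists_mem_abox` (`l_i = ⌈x_i L/(2π) + 1/2⌉ − 1`), **`iUnion_abox`** (`⋃_l abox L l = pbox (−π/L)`).
* §4 `apt L l p = (p + 2πl)/L` and **`setIntegral_abox_eq`**: `∫_{abox L l} g = L^{−(d+1)} • ∫_{BZ} g (apt L l p) dp` (translation by
  `2πl`, contraction by `L`: `measurePreserving_add_right`, `Measure.setIntegral_comp_smul_of_pos`).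
* §5 **`setIntegral_BZ_eq_sum_alias`**: for `g` continuous and `2π`-periodic in each coordinate and `L ≥ 1`,
  `∫_{BZ} g = L^{−(d+1)} • Σ_{l : Fin (d+1) → Fin L} ∫_{BZ} g ∘ apt L l` (`integral_biUnion_finset` over §3, then §4 termwise).
WHAT IS NOT HERE: any symbol, any lattice kernel (part 2), any object of an2's; anisotropic blockings (all coordinates are contracted by
the same `L` — the two-leg version is the SAME statement on `ℝ^{(d+1)+(d+1)}`, see part 2).
-/

noncomputable section

open Complex Set MeasureTheory
open scoped Real BigOperators Pointwise
open Literature.MathematicalPhysics.QuantumFieldTheory.Balaban1983to89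
open B4ContourShift (BZ)
open B4TorusKernel (rep)

namespace Summit.QuantumFields.BalabanUV.Beta.GAN24.AliasTiling

variable {d : ℕ}

/-! ## §1 Real-zone `2π`-periodicity in each coordinate -/

section Periodic

variable {g : (Fin (d + 1) → ℝ) → ℂ}

/-- [folklore] Integer iterates of the coordinate period: `g(p + 2πk e_i) = g(p)`, `k ∈ ℤ`. -/
theorem periodic_update_int (hper : ∀ (i : Fin (d + 1)) (p : Fin (d + 1) → ℝ), g (Function.update p i (p i + 2 * π)) = g p)
    (i : Fin (d + 1)) (p : Fin (d + 1) → ℝ) (k : ℤ) : g (Function.update p i (p i + 2 * π * k)) = g p := by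
  induction k using Int.induction_on generalizing p with
  | zero => simp
  | succ n ih =>
      have e : Function.update p i (p i + 2 * π * ((n : ℤ) + 1 : ℤ)) =
          Function.update (Function.update p i (p i + 2 * π * (n : ℤ))) i
            ((Function.update p i (p i + 2 * π * (n : ℤ))) i + 2 * π) := by
        funext j
        by_cases hj : j = i
        · subst hj; simp only [Function.update_self]; push_cast; ring
        · simp only [Function.update_of_ne hj]
      rw [e, hper, ih]
  | pred n ih =>
      have e : Function.update p i (p i + 2 * π * (-(n : ℤ) : ℤ)) =
          Function.update (Function.update p i (p i + 2 * π * (-(n : ℤ) - 1 : ℤ))) i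
            ((Function.update p i (p i + 2 * π * (-(n : ℤ) - 1 : ℤ))) i + 2 * π) := by
        funext j
        by_cases hj : j = i
        · subst hj; simp only [Function.update_self]; push_cast; ring
        · simp only [Function.update_of_ne hj]
      rw [← ih p, e, hper]

/-- [folklore] INTEGER-VECTOR PERIODICITY: `g(p + 2πk) = g(p)` for every `k ∈ ℤ^{d+1}`. -/
theorem periodic_add_intVec (hper : ∀ (i : Fin (d + 1)) (p : Fin (d + 1) → ℝ), g (Function.update p i (p i + 2 * π)) = g p)
    (p : Fin (d + 1) → ℝ) (k : Fin (d + 1) → ℤ) : g (fun i => p i + 2 * π * k i) = g p := by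
  classical
  have key : ∀ s : Finset (Fin (d + 1)), g (fun i => p i + if i ∈ s then 2 * π * (k i : ℝ) else 0) = g p := by
    intro s
    induction s using Finset.induction_on with
    | empty => simp
    | insert j s hj ih =>
        have e : (fun i => p i + if i ∈ insert j s then 2 * π * (k i : ℝ) else 0) =
            Function.update (fun i => p i + if i ∈ s then 2 * π * (k i : ℝ) else 0) j
              ((fun i => p i + if i ∈ s then 2 * π * (k i : ℝ) else 0) j + 2 * π * (k j : ℤ)) := by
          funext i
          by_cases hi : i = j
          · subst hi
            simp only [Function.update_self, Finset.mem_insert, true_or, if_true, hj, if_false, add_zero]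
          · rw [Function.update_of_ne hi]
            simp only [Finset.mem_insert, hi, false_or]
        rw [e, periodic_update_int hper, ih]
  simpa using key Finset.univ

end Periodic

/-! ## §2 Period boxes: the integral of a periodic function over `∏_i (a_i, a_i + 2π]` does not depend on the corner -/

section Boxes

/-- [folklore] The half-open PERIOD BOX with lower corner `a`: `∏_i (a_i, a_i + 2π]`. -/
def pbox (a : Fin (d + 1) → ℝ) : Set (Fin (d + 1) → ℝ) := Set.pi Set.univ (fun i => Ioc (a i) (a i + 2 * π))

/-- [folklore] Period boxes are measurable. -/
theorem measurableSet_pbox (a : Fin (d + 1) → ℝ) : MeasurableSet (pbox a) :=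
  MeasurableSet.univ_pi fun _ => measurableSet_Ioc

/-- [folklore] The unit cell `∏_i (b_i, b_i + 1]` (the fundamental domain of Mathlib's `UnitAddTorus.integral_preimage`). -/
def ucell (b : Fin (d + 1) → ℝ) : Set (Fin (d + 1) → ℝ) := {x | ∀ i, x i ∈ Ioc (b i) (b i + 1)}

/-- [folklore] The representative of a real number on `ℝ/ℤ` differs from it by an integer. -/
theorem rep_coe_eq_add_int (x : ℝ) : ∃ k : ℤ, rep ((x : ℝ) : UnitAddCircle) = x + k := by
  have h : ((rep ((x : ℝ) : UnitAddCircle) : ℝ) : UnitAddCircle) = ((x : ℝ) : UnitAddCircle) := AddCircle.coe_equivIco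
  rw [QuotientAddGroup.eq_iff_sub_mem, AddSubgroup.mem_zmultiples_iff] at h
  obtain ⟨k, hk⟩ := h
  refine ⟨k, ?_⟩
  have : (k : ℝ) = rep ((x : ℝ) : UnitAddCircle) - x := by simpa using hk
  linarith

/-- [folklore] CORNER INDEPENDENCE OF THE UNIT-CELL INTEGRAL of `x ↦ F(2πx)` for a `2πℤ^{d+1}`-periodic `F` (both corners give the
torus integral of the same function — Mathlib's `UnitAddTorus.integral_preimage`; re-proved from leaf-07's records
`LatticeKernelDiagonal` §2, credited, not importable at the time of writing). -/
theorem setIntegral_ucell_eq_of_periodic (F : (Fin (d + 1) → ℝ) → ℂ)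
    (hF : ∀ (p : Fin (d + 1) → ℝ) (k : Fin (d + 1) → ℤ), F (fun i => p i + 2 * π * k i) = F p) (b b' : Fin (d + 1) → ℝ) :
    ∫ x in ucell b, F ((2 * π) • x) = ∫ x in ucell b', F ((2 * π) • x) := by
  let f : UnitAddTorus (Fin (d + 1)) → ℂ := fun t => F (fun i => 2 * π * rep (t i))
  have key : ∀ x : Fin (d + 1) → ℝ, f (fun i => ((x i : ℝ) : UnitAddCircle)) = F ((2 * π) • x) := by
    intro x
    choose k hk using fun i => rep_coe_eq_add_int (x i)
    show F (fun i => 2 * π * rep ((x i : ℝ) : UnitAddCircle)) = F ((2 * π) • x)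
    have e : (fun i => 2 * π * rep ((x i : ℝ) : UnitAddCircle)) = fun i => ((2 * π) • x) i + 2 * π * (k i : ℝ) := by
      funext i; rw [hk i, Pi.smul_apply, smul_eq_mul]; ring
    rw [e]
    exact hF _ k
  have h1 := UnitAddTorus.integral_preimage f b
  have h2 := UnitAddTorus.integral_preimage f b'
  rw [h1] at h2
  have hm : ∀ c : Fin (d + 1) → ℝ, MeasurableSet (ucell c) := fun c => by
    have : ucell c = Set.pi Set.univ (fun i => Ioc (c i) (c i + 1)) := by ext x; simp [ucell]
    rw [this]; exact MeasurableSet.univ_pi fun _ => measurableSet_Ioc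
  calc ∫ x in ucell b, F ((2 * π) • x) = ∫ x in ucell b, f (fun i => ((x i : ℝ) : UnitAddCircle)) :=
        setIntegral_congr_fun (hm b) (fun x _ => (key x).symm)
    _ = ∫ x in ucell b', f (fun i => ((x i : ℝ) : UnitAddCircle)) := h2
    _ = ∫ x in ucell b', F ((2 * π) • x) := setIntegral_congr_fun (hm b') (fun x _ => key x)

/-- [folklore] A period box is the `2π`-dilate of a unit cell. -/
theorem pbox_eq_smul_ucell (a : Fin (d + 1) → ℝ) : pbox a = (2 * π) • ucell ((2 * π)⁻¹ • a) := by
  have hpos : (0 : ℝ) < 2 * π := by positivity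
  ext y
  rw [Set.mem_smul_set_iff_inv_smul_mem₀ hpos.ne']
  simp only [pbox, ucell, Set.mem_univ_pi, Set.mem_Ioc, Set.mem_setOf_eq, Pi.smul_apply, smul_eq_mul]
  refine forall_congr' fun i => ?_
  have hi : (0 : ℝ) < (2 * π)⁻¹ := inv_pos.mpr hpos
  have e : (2 * π)⁻¹ * a i + 1 = (2 * π)⁻¹ * (a i + 2 * π) := by field_simp
  rw [e]
  constructor
  · rintro ⟨h1, h2⟩
    exact ⟨mul_lt_mul_of_pos_left h1 hi, mul_le_mul_of_nonneg_left h2 hi.le⟩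
  · rintro ⟨h1, h2⟩
    have h1' := mul_lt_mul_of_pos_left h1 hpos
    have h2' := mul_le_mul_of_nonneg_left h2 hpos.le
    simp only [mul_inv_cancel_left₀ hpos.ne'] at h1' h2'
    exact ⟨h1', h2'⟩

/-- [folklore] **CORNER INDEPENDENCE OF THE PERIOD-BOX INTEGRAL**: for `F` with `F(p + 2πk) = F(p)` (`k ∈ ℤ^{d+1}`) the integral over
`∏_i (a_i, a_i + 2π]` is the same for every corner `a` (no integrability needed: junk values agree too). -/
theorem setIntegral_pbox_eq_of_periodic (F : (Fin (d + 1) → ℝ) → ℂ)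
    (hF : ∀ (p : Fin (d + 1) → ℝ) (k : Fin (d + 1) → ℤ), F (fun i => p i + 2 * π * k i) = F p) (a a' : Fin (d + 1) → ℝ) :
    ∫ y in pbox a, F y = ∫ y in pbox a', F y := by
  have hpos : (0 : ℝ) < 2 * π := by positivity
  have h := fun c : Fin (d + 1) → ℝ => Measure.setIntegral_comp_smul_of_pos volume F (ucell c) hpos
  rw [pbox_eq_smul_ucell a, pbox_eq_smul_ucell a']
  have hne : ((2 * π) ^ Module.finrank ℝ (Fin (d + 1) → ℝ))⁻¹ ≠ (0 : ℝ) := inv_ne_zero (pow_ne_zero _ hpos.ne')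
  have ha := h ((2 * π)⁻¹ • a)
  have ha' := h ((2 * π)⁻¹ • a')
  rw [setIntegral_ucell_eq_of_periodic F hF ((2 * π)⁻¹ • a) ((2 * π)⁻¹ • a')] at ha
  rw [ha] at ha'
  exact smul_right_injective _ hne ha'

/-- [folklore] The centred period box `∏_i (−π, π]` is the Brillouin zone up to a null set. -/
theorem pbox_neg_pi_ae_eq_BZ : pbox (fun _ : Fin (d + 1) => -π) =ᵐ[volume] BZ (d + 1) := by
  have e : pbox (fun _ : Fin (d + 1) => -π) = Set.pi Set.univ (fun _ => Ioc (-π) π) := by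
    unfold pbox; congr 1; funext i; congr 1; ring
  rw [e, BZ, volume_pi]
  exact Measure.univ_pi_Ioc_ae_eq_Icc

/-- [folklore] Hence **EVERY PERIOD BOX INTEGRATES A PERIODIC FUNCTION LIKE THE BRILLOUIN ZONE**. -/
theorem setIntegral_pbox_eq_BZ (F : (Fin (d + 1) → ℝ) → ℂ)
    (hF : ∀ (p : Fin (d + 1) → ℝ) (k : Fin (d + 1) → ℤ), F (fun i => p i + 2 * π * k i) = F p) (a : Fin (d + 1) → ℝ) :
    ∫ y in pbox a, F y = ∫ y in BZ (d + 1), F y := by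
  rw [setIntegral_pbox_eq_of_periodic F hF a (fun _ => -π)]
  exact setIntegral_congr_set pbox_neg_pi_ae_eq_BZ

end Boxes

/-! ## §3 The `L^{d+1}` alias boxes tile a period box -/

section Alias

variable (L : ℕ)

/-- [folklore] Lower corners of the alias boxes: `((2l_i − 1)π)/L`. -/
def alo (L : ℕ) (l : Fin (d + 1) → Fin L) : Fin (d + 1) → ℝ := fun i => (2 * ((l i : ℕ) : ℝ) - 1) * π / L

/-- [folklore] Upper corners of the alias boxes: `((2l_i + 1)π)/L`. -/
def ahi (L : ℕ) (l : Fin (d + 1) → Fin L) : Fin (d + 1) → ℝ := fun i => (2 * ((l i : ℕ) : ℝ) + 1) * π / L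

/-- [folklore] THE ALIAS BOX of index `l ∈ {0,…,L−1}^{d+1}`: `∏_i (((2l_i − 1)π)/L, ((2l_i + 1)π)/L]` — the image of the half-open
Brillouin zone under `p ↦ (p + 2πl)/L`. -/
def abox (L : ℕ) (l : Fin (d + 1) → Fin L) : Set (Fin (d + 1) → ℝ) := Set.pi Set.univ (fun i => Ioc (alo L l i) (ahi L l i))

/-- [folklore] Alias boxes are measurable. -/
theorem measurableSet_abox (l : Fin (d + 1) → Fin L) : MeasurableSet (abox L l) :=
  MeasurableSet.univ_pi fun _ => measurableSet_Ioc

/-- [folklore] An alias box lies in the closed box with the same corners. -/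
theorem abox_subset_Icc (l : Fin (d + 1) → Fin L) : abox L l ⊆ Icc (alo L l) (ahi L l) := by
  intro x hx
  simp only [abox, Set.mem_univ_pi, Set.mem_Ioc] at hx
  exact ⟨fun i => (hx i).1.le, fun i => (hx i).2⟩

/-- [folklore] `L > 0` as soon as an alias index exists. -/
theorem cast_pos_of_fin (l : Fin (d + 1) → Fin L) : (0 : ℝ) < L := by
  exact_mod_cast Fin.pos (l 0)

/-- [folklore] DISTINCT ALIAS BOXES ARE DISJOINT. -/
theorem disjoint_abox {l l' : Fin (d + 1) → Fin L} (h : l ≠ l') : Disjoint (abox L l) (abox L l') := by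
  obtain ⟨i, hi⟩ := Function.ne_iff.mp h
  have hL : (0 : ℝ) < L := cast_pos_of_fin L l
  rw [Set.disjoint_left]
  intro x hx hx'
  simp only [abox, alo, ahi, Set.mem_univ_pi, Set.mem_Ioc] at hx hx'
  obtain ⟨h1, h2⟩ := hx i
  obtain ⟨h1', h2'⟩ := hx' i
  rw [le_div_iff₀ hL] at h2 h2'
  rw [div_lt_iff₀ hL] at h1 h1'
  rcases lt_or_gt_of_ne (Fin.val_ne_of_ne hi) with hlt | hlt
  · have hle : ((l i : ℕ) : ℝ) + 1 ≤ ((l' i : ℕ) : ℝ) := by exact_mod_cast hlt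
    nlinarith [Real.pi_pos]
  · have hle : ((l' i : ℕ) : ℝ) + 1 ≤ ((l i : ℕ) : ℝ) := by exact_mod_cast hlt
    nlinarith [Real.pi_pos]

/-- [folklore] Every alias box lies in the period box with corner `−π/L`. -/
theorem abox_subset_pbox (l : Fin (d + 1) → Fin L) : abox L l ⊆ pbox (fun _ => -(π / L)) := by
  have hL : (0 : ℝ) < L := cast_pos_of_fin L l
  intro x hx
  simp only [abox, alo, ahi, Set.mem_univ_pi, Set.mem_Ioc] at hx
  simp only [pbox, Set.mem_univ_pi, Set.mem_Ioc]
  intro i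
  obtain ⟨h1, h2⟩ := hx i
  have hl0 : (0 : ℝ) ≤ ((l i : ℕ) : ℝ) := Nat.cast_nonneg _
  have hlL : ((l i : ℕ) : ℝ) + 1 ≤ (L : ℝ) := by exact_mod_cast (l i).isLt
  rw [div_lt_iff₀ hL] at h1
  rw [le_div_iff₀ hL] at h2
  constructor
  · have : -(π / L) * L = -π := by field_simp
    nlinarith [Real.pi_pos]
  · have : (-(π / L) + 2 * π) * L = 2 * π * L - π := by field_simp; ring
    nlinarith [Real.pi_pos]

/-- [folklore] Every point of the period box with corner `−π/L` lies in some alias box: `l_i = ⌈x_i L/(2π) + 1/2⌉ − 1`. -/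
theorem exists_mem_abox [NeZero L] {x : Fin (d + 1) → ℝ} (hx : x ∈ pbox (fun _ => -(π / L))) : ∃ l, x ∈ abox L l := by
  have hL : (0 : ℝ) < L := Nat.cast_pos.mpr (Nat.pos_of_ne_zero (NeZero.ne L))
  have hπ : (0 : ℝ) < π := Real.pi_pos
  simp only [pbox, Set.mem_univ_pi, Set.mem_Ioc] at hx
  -- the real index and its integer ceiling
  let t : Fin (d + 1) → ℝ := fun i => x i * L / (2 * π) + 1 / 2
  have ht0 : ∀ i, 0 < t i := by
    intro i
    have h1 := (hx i).1
    have : -(π / L) * L / (2 * π) + 1 / 2 = (0 : ℝ) := by field_simp; ring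
    have hm : -(π / L) * L / (2 * π) < x i * L / (2 * π) :=
      div_lt_div_of_pos_right (mul_lt_mul_of_pos_right h1 hL) (by positivity)
    simp only [t]; linarith
  have htL : ∀ i, t i ≤ L := by
    intro i
    have h2 := (hx i).2
    have : (-(π / L) + 2 * π) * L / (2 * π) + 1 / 2 = (L : ℝ) := by field_simp; ring
    have hm : x i * L / (2 * π) ≤ (-(π / L) + 2 * π) * L / (2 * π) :=
      div_le_div_of_nonneg_right (mul_le_mul_of_nonneg_right h2 hL.le) (by positivity)
    simp only [t]; linarith
  have hn1 : ∀ i, 1 ≤ ⌈t i⌉ := fun i => Int.one_le_ceil_iff.mpr (ht0 i)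
  have hnL : ∀ i, ⌈t i⌉ ≤ (L : ℤ) := fun i => Int.ceil_le.mpr (by exact_mod_cast htL i)
  refine ⟨fun i => ⟨(⌈t i⌉ - 1).toNat, ?_⟩, ?_⟩
  · have h0 : 0 ≤ ⌈t i⌉ - 1 := by linarith [hn1 i]
    have : ((⌈t i⌉ - 1).toNat : ℤ) < L := by rw [Int.toNat_of_nonneg h0]; linarith [hnL i]
    exact_mod_cast this
  · simp only [abox, alo, ahi, Set.mem_univ_pi, Set.mem_Ioc]
    intro i
    have h0 : 0 ≤ ⌈t i⌉ - 1 := by linarith [hn1 i]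
    have hcast : (((⌈t i⌉ - 1).toNat : ℕ) : ℝ) = (⌈t i⌉ : ℝ) - 1 := by
      have : (((⌈t i⌉ - 1).toNat : ℕ) : ℤ) = ⌈t i⌉ - 1 := Int.toNat_of_nonneg h0
      exact_mod_cast this
    rw [hcast]
    have hlt : (⌈t i⌉ : ℝ) - 1 < t i := by
      have := Int.ceil_lt_add_one (t i); linarith
    have hle : t i ≤ (⌈t i⌉ : ℝ) := Int.le_ceil (t i)
    have ex : x i = (t i - 1 / 2) * (2 * π) / L := by simp only [t]; field_simp; ring
    rw [ex, div_lt_div_iff_of_pos_right hL, div_le_div_iff_of_pos_right hL]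
    constructor <;> nlinarith

/-- [folklore] **THE ALIAS BOXES TILE THE PERIOD BOX** with corner `−π/L`: `⋃_l ∏_i (((2l_i−1)π)/L, ((2l_i+1)π)/L] = ∏_i (−π/L, 2π − π/L]`. -/
theorem iUnion_abox [NeZero L] : (⋃ l, abox L l) = pbox (fun _ : Fin (d + 1) => -(π / L)) := by
  apply Set.Subset.antisymm
  · exact Set.iUnion_subset fun l => abox_subset_pbox L l
  · intro x hx
    obtain ⟨l, hl⟩ := exists_mem_abox L hx
    exact Set.mem_iUnion.mpr ⟨l, hl⟩

/-! ## §4 Each alias box is the Brillouin zone, translated by `2πl` and contracted by `L` -/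

/-- [folklore] THE REAL ALIAS MOMENTA over the coarse momentum `p`: `(p_i + 2π l_i)/L`. -/
def apt (L : ℕ) (l : Fin (d + 1) → Fin L) (p : Fin (d + 1) → ℝ) : Fin (d + 1) → ℝ := fun i => (p i + 2 * π * (l i : ℕ)) / L

/-- [folklore] **CHANGE OF VARIABLES ON ONE ALIAS BOX**: `∫_{abox l} g = L^{−(d+1)} ∫_{p ∈ BZ} g((p + 2πl)/L) dp` (translation invariance and
the scaling law of Lebesgue measure on `ℝ^{d+1}`; unconditional in `g`). -/
theorem setIntegral_abox_eq [NeZero L] (g : (Fin (d + 1) → ℝ) → ℂ) (l : Fin (d + 1) → Fin L) :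
    ∫ k in abox L l, g k = (((L : ℝ) ^ (d + 1))⁻¹ : ℝ) • ∫ p in BZ (d + 1), g (apt L l p) := by
  have hL : (0 : ℝ) < L := Nat.cast_pos.mpr (Nat.pos_of_ne_zero (NeZero.ne L))
  set c : Fin (d + 1) → ℝ := fun i => 2 * π * (l i : ℕ) with hc
  set S : Set (Fin (d + 1) → ℝ) := (fun q => q - c) ⁻¹' BZ (d + 1) with hS
  -- translation
  have hmp := measurePreserving_add_right (volume : Measure (Fin (d + 1) → ℝ)) c
  have hemb : MeasurableEmbedding (fun x : Fin (d + 1) → ℝ => x + c) := (MeasurableEquiv.addRight c).measurableEmbedding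
  have h1 := hmp.setIntegral_preimage_emb hemb (fun q => g ((L : ℝ)⁻¹ • q)) S
  have hpre : (fun x : Fin (d + 1) → ℝ => x + c) ⁻¹' S = BZ (d + 1) := by
    ext p; simp [hS]
  rw [hpre] at h1
  -- scaling
  have h2 := Measure.setIntegral_comp_smul_of_pos volume g S (inv_pos.mpr hL)
  rw [Module.finrank_fin_fun] at h2
  have hA : ((L : ℝ)⁻¹) ^ (d + 1) ≠ 0 := pow_ne_zero _ (inv_ne_zero hL.ne')
  have h3 : ((L : ℝ)⁻¹) ^ (d + 1) • ∫ q in S, g ((L : ℝ)⁻¹ • q) = ∫ y in (L : ℝ)⁻¹ • S, g y := (eq_inv_smul_iff₀ hA).mp h2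
  -- the contracted translated zone is the closed alias box
  have hset : (L : ℝ)⁻¹ • S = Icc (alo L l) (ahi L l) := by
    ext y
    rw [Set.mem_smul_set_iff_inv_smul_mem₀ (inv_ne_zero hL.ne'), inv_inv]
    simp only [hS, hc, Set.mem_preimage, BZ, Set.mem_Icc, Pi.le_def, Pi.sub_apply, Pi.smul_apply, smul_eq_mul, alo, ahi]
    simp only [← forall_and]
    refine forall_congr' fun i => ?_
    rw [div_le_iff₀ hL, le_div_iff₀ hL]
    constructor <;> rintro ⟨h1, h2⟩ <;> constructor <;> nlinarith
  have hg : ∀ p, g ((L : ℝ)⁻¹ • (p + c)) = g (apt L l p) := by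
    intro p; congr 1; funext i
    simp only [Pi.smul_apply, Pi.add_apply, smul_eq_mul, apt, hc, div_eq_inv_mul]
  calc ∫ k in abox L l, g k = ∫ k in Icc (alo L l) (ahi L l), g k :=
        setIntegral_congr_set (by rw [abox, volume_pi]; exact Measure.univ_pi_Ioc_ae_eq_Icc)
    _ = ∫ y in (L : ℝ)⁻¹ • S, g y := by rw [hset]
    _ = ((L : ℝ)⁻¹) ^ (d + 1) • ∫ p in BZ (d + 1), g ((L : ℝ)⁻¹ • (p + c)) := by rw [← h3, h1]
    _ = (((L : ℝ) ^ (d + 1))⁻¹ : ℝ) • ∫ p in BZ (d + 1), g (apt L l p) := by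
        rw [inv_pow]
        congr 1
        refine integral_congr_ae (Filter.Eventually.of_forall fun p => ?_)
        exact hg p

/-! ## §5 The zone integral of a periodic function is the alias average of its contracted translates -/

/-- [folklore] **DECIMATION = ALIASING, pure form**: for a continuous `g : ℝ^{d+1} → ℂ` that is `2π`-periodic in each coordinate,
`∫_{[−π,π]^{d+1}} g(k) dk = L^{−(d+1)} Σ_{l ∈ {0,…,L−1}^{d+1}} ∫_{[−π,π]^{d+1}} g((p + 2πl)/L) dp`. -/
theorem setIntegral_BZ_eq_sum_alias [NeZero L] (g : (Fin (d + 1) → ℝ) → ℂ)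
    (hper : ∀ (i : Fin (d + 1)) (p : Fin (d + 1) → ℝ), g (Function.update p i (p i + 2 * π)) = g p) (hg : Continuous g) :
    ∫ k in BZ (d + 1), g k = (((L : ℝ) ^ (d + 1))⁻¹ : ℝ) • ∑ l : Fin (d + 1) → Fin L, ∫ p in BZ (d + 1), g (apt L l p) := by
  have hF : ∀ (p : Fin (d + 1) → ℝ) (k : Fin (d + 1) → ℤ), g (fun i => p i + 2 * π * k i) = g p := periodic_add_intVec hper
  rw [← setIntegral_pbox_eq_BZ g hF (fun _ => -(π / L)), ← iUnion_abox L]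
  have hU : (⋃ l, abox L l) = ⋃ l ∈ (Finset.univ : Finset (Fin (d + 1) → Fin L)), abox L l := by simp
  rw [hU, integral_biUnion_finset Finset.univ (fun l _ => measurableSet_abox L l) (fun l _ l' _ h => disjoint_abox L h)
      (fun l _ => (hg.continuousOn.integrableOn_compact isCompact_Icc).mono_set (abox_subset_Icc L l))]
  rw [Finset.smul_sum]
  exact Finset.sum_congr rfl fun l _ => setIntegral_abox_eq L g l

end Alias

end Summit.QuantumFields.BalabanUV.Beta.GAN24.AliasTiling

end
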